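import Summits.AnomalousDissipation.AnomalousDissipation.Theorems.MomentParityQuarticTightnessHorizonKrylovBogoliubov
import Summits.AnomalousDissipation.AnomalousDissipation.Theorems.MomentParityGalerkinInvariantLoudStubEnergyFloor

/-!
# Route MomentParity · crux `QuarticTightness` (stmt-AnomalousDissipation-14331), line `horizon-shooting`:
# stub S13 — SHORT HORIZONS ARE FREE (calibration; `(ν, N)`-uniform budgets)

Support file (`--supports stmt-AnomalousDissipation-14331`) of the line lead
(prover-line-stmt-AnomalousDissipation-14331-c13-0; skeleton `Cruxes/QuarticTightness/Lines/Ideate3Sketch.lean`).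
It proves the registered stub

* `stub_shortHorizonLoud` (S13) — for every smooth divergence-free mean-zero force `f ≠ 0` there are a horizon
  `T₁ > 0`, budgets `E₁`, `ε₁ > 0`, a viscosity `ν₁ > 0` and a level `N₀` such that for all `0 < ν ≤ ν₁`,
  `N ≥ N₀` and every SHORT horizon `0 < T ≤ T₁` some mean-zero Galerkin datum `a` of order `N` in the absorbing
  ball `‖a‖₂ ≤ ‖f‖₂/(4π²ν)` has window work `∫₀ᵀ (f, u_t) dt ≥ ε₁ T` and window energy `∫₀ᵀ ‖u_t‖² dt ≤ E₁ T`
  (`u_t = Torus.galerkinFlow ν f N t a`), with budgets that do NOT depend on `(ν, N)`. This calibrates the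
  line's open stub S6\* (gate hypothesis ⇒ horizon loudness at EVERY horizon): its whole content is `T → ∞`.

Proof. Shoot the truncated force `a := P_N f` (a level-`N` band test, hence a mean-zero Galerkin mode; Bessel
`‖P_N f‖₂² ≤ F := ‖f‖₂²`, so `a` is in the absorbing ball as soon as `4π²ν ≤ 1`). ENERGY: at coefficient
level the orbit energy `ψ = ‖u_t‖₂²` has `ψ' = 2(−ν‖∇u‖² + (P_N f, u)) ≤ ψ + ‖P_N f‖₂² ≤ ψ + F`
(`hasDerivWithinAt_energy`, `energy_deriv_le`), so Grönwall gives `‖u_t‖₂² ≤ 2Fe =: E` on `[0, 1]`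
(`integral_norm_sq_galerkinFlow_le`). WORK: the work `W(t) = (f, u_t) = (u_t, P_N f)` (the slices are level
`N`) starts at `W(0) = ‖P_N f‖₂² > F/2` for `N ≥ N₀` (Parseval) and, by the tested Galerkin equations
(`IsGalerkinMode.galerkinFlow_clauses`, clause 4, along the `H`-valued lift `stub_orbitLift`), has increments
`W(t) − W(0) = ∫₀ᵗ ⟨F(u_τ), P_N f⟩ dτ` with `|⟨F(u), P_N f⟩| ≤ F + ν‖ΔP_N f‖₂‖u‖ + G‖u‖² ≤ F + L√E + GE =: C`
(`abs_nsGeneratorPairing_le`; `G` bounds `Σᵢ‖∂ᵢP_N f‖` and `L = ‖Δf‖₂ ≥ ‖ΔP_N f‖₂` uniformly in `N`,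
`ν ≤ 1`). Hence `W ≥ F/2 − Ct ≥ F/4` on `[0, T₁]`, `T₁ := min 1 (F/(4C))`, and `∫₀ᵀ W ≥ (F/4)T`,
`∫₀ᵀ‖u_t‖² ≤ ET` for `T ≤ T₁`. Constants: `ε₁ = F/4`, `E₁ = 2Fe`, `ν₁ = min 1 (4π²)⁻¹`.

Sources: energy inequality and absorbing ball of the Galerkin system (Constantin–Foias 1988, Ch. 8,
(8.3)–(8.9); Robinson–Rodrigo–Sadowski 2016, Thm. 4.4 Steps 1–2, (4.5)–(4.8)); the generator of a cylindrical
functional along Galerkin orbits (FMRT 2001, Ch. IV App. B.2). No new definitions; no theorem here concludes a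
Theses decl.
-/

noncomputable section

-- `Summit.<Summit>.<Problem>` is the tree's mandated summit-side namespace (CONVENTIONS §2); for this
-- single-conjunct summit the two coincide, so the duplicate is deliberate.
set_option linter.dupNamespace false

namespace Summit.AnomalousDissipation.AnomalousDissipation.Theorems.MomentParityQuarticTightness

open MeasureTheory Filter Topology Set Function
open scoped ENNReal InnerProductSpace RealInnerProductSpace
open Literature.Analysis.FunctionSpaces Literature.Analysis.FunctionSpaces.Torus
open Literature.Analysis.FluidPDE Literature.Analysis.FluidPDE.Torus
open Summit.AnomalousDissipation.AnomalousDissipation.Theses.MomentParity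
open Summit.AnomalousDissipation.AnomalousDissipation.Theorems
open Summit.AnomalousDissipation.AnomalousDissipation.Theorems.QuarticGate.Negative
open Summit.AnomalousDissipation.AnomalousDissipation.Theorems.QuarticTightness.Negative
open Summit.AnomalousDissipation.AnomalousDissipation.Theorems.CubicParityLoud.Negative (T3 R3 H3 L2T3)

/-! ## A. Energy of a Galerkin orbit on the unit window, uniformly in `(ν, N)` -/

/-- **Energy along a Galerkin orbit on the unit time window, uniformly in `(ν, N)`.** For `ν ≥ 0`, a smooth
force `f` with `∫‖f‖² ≤ F` and a Galerkin mode `a` of order `N` with `∫‖a‖² ≤ F`, the orbit has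
`∫‖galerkinFlow ν f N t a‖² ≤ 2Fe` for `t ∈ [0, 1]`: at coefficient level (Parseval,
`IsGalerkinMode.galerkinFlow_eq`) the energy `ψ = Σ_k ‖α k‖²` of the coefficient orbit
`α = galerkinCoeffFlow ν (f̂|_{≤N}) · (â|_{≤N})` has `ψ' = 2(−ν‖∇u‖² + ∫⟪P_N f, u⟫) ≤ ψ + Σ_k ‖f̂ k‖² ≤ ψ + F`
(`hasDerivWithinAt_energy`, `energy_deriv_le`, Bessel), and Grönwall
(`le_gronwallBound_of_liminf_deriv_right_le`) gives `ψ t ≤ ψ 0 eᵗ + F(eᵗ − 1) ≤ 2Fe`.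
[folklore; Constantin–Foias 1988, Ch. 8, (8.7)–(8.9); Robinson–Rodrigo–Sadowski 2016, Thm. 4.4 Step 2,
(4.7)–(4.8)] -/
theorem integral_norm_sq_galerkinFlow_le {ν : ℝ} (hν : 0 ≤ ν) {f a : T3 → R3} (hf : Torus.IsSmooth f)
    {N : ℕ} (ha : IsGalerkinMode N a) {F : ℝ} (hfF : ∫ x, ‖f x‖ ^ 2 ≤ F) (haF : ∫ x, ‖a x‖ ^ 2 ≤ F)
    {t : ℝ} (ht : t ∈ Icc (0 : ℝ) 1) :
    ∫ x, ‖Torus.galerkinFlow ν f N t a x‖ ^ 2 ≤ 2 * F * Real.exp 1 := by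
  have hS : ∀ k ∈ Torus.freqBall (d := Fin 3) N, -k ∈ Torus.freqBall (d := Fin 3) N :=
    Torus.neg_mem_freqBall_of_mem
  have hgr : Torus.IsRealCoeff (fourierRestrict (Torus.freqBall (d := Fin 3) N) f) :=
    Torus.isRealCoeff_mFourierCoeff hf.integrable
  have hsol := isGalerkinODESolution_galerkinCoeffFlow hν hS hgr ha.fourierRestrict_mem (ν := ν)
  -- Parseval along the orbit
  have hpars : ∀ τ, ∫ x, ‖Torus.galerkinFlow ν f N τ a x‖ ^ 2 =
      ∑ k, ‖galerkinCoeffFlow ν (fourierRestrict (Torus.freqBall N) f) τ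
        (fourierRestrict (Torus.freqBall N) a) k‖ ^ 2 := by
    intro τ
    rw [ha.galerkinFlow_eq τ,
      Torus.integral_norm_sq_realTrigPoly hS ((hsol.mem τ).1.isConjSymm_coeffExt hS),
      Torus.sum_coeffExt (fun _ v => ‖v‖ ^ 2)]
  -- Bessel for the force coefficients: `Σ_{|k|≤N} ‖f̂ k‖² = ‖P_N f‖₂² ≤ ‖f‖₂² ≤ F`
  have hgF : ∑ k, ‖fourierRestrict (Torus.freqBall (d := Fin 3) N) f k‖ ^ 2 ≤ F := by
    rw [← Torus.sum_coeffExt (fun _ v => ‖v‖ ^ 2) (fourierRestrict (Torus.freqBall N) f),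
      ← Torus.integral_norm_sq_realTrigPoly hS (hgr.isConjSymm_coeffExt hS),
      realTrigPoly_coeffExt_fourierRestrict]
    exact (Torus.integral_norm_sq_fourierTruncate_le (hf.memLp 2) N).trans hfF
  -- the datum: `Σ_{|k|≤N} ‖â k‖² = ‖a‖₂² ≤ F` (`P_N a = a`)
  have h0F : ∑ k, ‖fourierRestrict (Torus.freqBall (d := Fin 3) N) a k‖ ^ 2 ≤ F := by
    rw [← Torus.sum_coeffExt (fun _ v => ‖v‖ ^ 2) (fourierRestrict (Torus.freqBall N) a),
      ← Torus.integral_norm_sq_realTrigPoly hS (ha.fourierRestrict_mem.1.isConjSymm_coeffExt hS),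
      ha.realTrigPoly_fourierRestrict]
    exact haF
  -- the energy of the coefficient orbit and its derivative along the Galerkin ODE
  set α : ℝ → ↥(Torus.freqBall (d := Fin 3) N) → EuclideanSpace ℂ (Fin 3) := fun τ =>
    galerkinCoeffFlow ν (fourierRestrict (Torus.freqBall N) f) τ (fourierRestrict (Torus.freqBall N) a)
    with hα
  set ψ : ℝ → ℝ := fun τ => ∑ k, ‖α τ k‖ ^ 2 with hψ
  set ψ' : ℝ → ℝ := fun τ =>
    2 * (-(ν * (eGradNormSq (Torus.realTrigPoly (Torus.freqBall N)
      (Torus.coeffExt (Torus.freqBall N) (α τ)))).toReal) +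
      ∫ x, ⟪Torus.realTrigPoly (Torus.freqBall N)
          (Torus.coeffExt (Torus.freqBall N) (fourierRestrict (Torus.freqBall N) f)) x,
        Torus.realTrigPoly (Torus.freqBall N) (Torus.coeffExt (Torus.freqBall N) (α τ)) x⟫_ℝ) with hψ'
  have hderiv : ∀ τ ∈ Icc (0 : ℝ) 1, HasDerivWithinAt ψ (ψ' τ) (Icc 0 1) τ := fun τ hτ =>
    hasDerivWithinAt_energy ν hS (hsol.hasDerivWithinAt 1 τ hτ) (hsol.mem τ) hgr
  have hcont : ContinuousOn ψ (Icc 0 1) := fun τ hτ => (hderiv τ hτ).continuousWithinAt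
  -- Grönwall with `K = 1`, `ε = F`
  have hbound : ∀ τ ∈ Ico (0 : ℝ) 1, ψ' τ ≤ 1 * ψ τ + F := fun τ _ =>
    (energy_deriv_le ν hν hS (hsol.mem τ) hgr).trans (by linarith)
  have hgron := le_gronwallBound_of_liminf_deriv_right_le (f := ψ) (f' := ψ') (δ := ψ 0) (K := 1)
    (ε := F) (a := 0) (b := 1) hcont (fun τ hτ r hr => ?_) le_rfl hbound t ht
  · rw [sub_zero] at hgron
    have hgb := congrFun (gronwallBound_of_K_ne_0 (δ := ψ 0) (ε := F) one_ne_zero) t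
    simp only [one_mul, div_one] at hgb
    rw [hpars t]
    refine hgron.trans ?_
    rw [hgb]
    have hψ0 : ψ 0 ≤ F := by
      show ∑ k, ‖α 0 k‖ ^ 2 ≤ F
      rw [hsol.initial]
      exact h0F
    have hψ0' : 0 ≤ ψ 0 := Finset.sum_nonneg fun k _ => sq_nonneg _
    have hF0 : 0 ≤ F := hψ0'.trans hψ0
    have hexp : Real.exp t ≤ Real.exp 1 := Real.exp_le_exp.2 ht.2
    have h1 : 1 ≤ Real.exp t := Real.one_le_exp ht.1
    have e0 : 0 ≤ Real.exp t := (Real.exp_pos t).le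
    have h2 : ψ 0 * Real.exp t ≤ F * Real.exp t := mul_le_mul_of_nonneg_right hψ0 e0
    have h3 : F * Real.exp t ≤ F * Real.exp 1 := mul_le_mul_of_nonneg_left hexp hF0
    nlinarith
  · -- the liminf condition from the one-sided derivative
    have hmem_nhds : Icc (0 : ℝ) 1 ∈ 𝓝[Ici τ] τ :=
      mem_nhdsWithin.2 ⟨Iio 1, isOpen_Iio, hτ.2, fun z hz => ⟨hτ.1.trans hz.2, hz.1.le⟩⟩
    exact ((hderiv τ (Ico_subset_Icc_self hτ)).mono_of_mem_nhdsWithin hmem_nhds)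
      |>.liminf_right_slope_le hr

/-! ## B. The tested generator is bounded on balls of `H` -/

/-- **The tested generator is bounded on balls of `H`.** For `ν ≥ 0`, a smooth test field `g` with
`Σᵢ‖∂ᵢg‖ ≤ G` and `u ∈ H`: `|⟨F(u), g⟩| ≤ |∫⟪f, g⟫| + ν‖Δg‖₂‖u‖ + G‖u‖²` — Cauchy–Schwarz for the Stokes
term (`Torus.abs_pairing_coe_le`) and `|∫(u ⊗ u):∇g| ≤ G‖u‖²` for the inertial term
(`Torus.integrable_inner_fderiv_apply_coe`). [folklore; FMRT 2001, Ch. IV App. B.2] -/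
theorem abs_nsGeneratorPairing_le {ν : ℝ} (hν : 0 ≤ ν) (f : T3 → R3) {g : T3 → R3}
    (hg : Torus.IsSmooth g) {G : ℝ} (hG : ∀ x, ∑ i, ‖Torus.partialDeriv i g x‖ ≤ G) (u : H3) :
    |Torus.nsGeneratorPairing ν f u g| ≤
      |∫ x, ⟪f x, g x⟫_ℝ| + ν * Real.sqrt (∫ x, ‖Torus.laplacian g x‖ ^ 2) * ‖u‖ + G * ‖u‖ ^ 2 := by
  have hΔ : MemLp (Torus.laplacian g) 2 volume := hg.laplacian.memLp 2
  have hP : |Torus.pairing u.1 (Torus.laplacian g)| ≤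
      Real.sqrt (∫ x, ‖Torus.laplacian g x‖ ^ 2) * ‖u‖ := by
    have h := Torus.abs_pairing_coe_le hΔ u
    rw [CubicParityLoud.Negative.norm_toLp_eq_sqrt] at h
    exact h.trans_eq (mul_comm _ _)
  have hQ : |Torus.inertialPairing (u : L2T3) g| ≤ G * ‖u‖ ^ 2 := by
    have h := (Torus.integrable_inner_fderiv_apply_coe hg hG (u : L2T3) (u : L2T3)).2
    rw [Torus.inertialPairing, sq]
    exact h
  have hexp : Torus.nsGeneratorPairing ν f u g =
      (∫ x, ⟪f x, g x⟫_ℝ) + ν * Torus.pairing u.1 (Torus.laplacian g) +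
        Torus.inertialPairing (u : L2T3) g := rfl
  rw [hexp]
  refine (abs_add_le _ _).trans (add_le_add ((abs_add_le _ _).trans (add_le_add le_rfl ?_)) hQ)
  rw [abs_mul, abs_of_nonneg hν, mul_assoc]
  exact mul_le_mul_of_nonneg_left hP hν

/-! ## C. The registered stub -/

/-- **S13 — SHORT HORIZONS ARE FREE (calibration; registered stub of the line `horizon-shooting`).** For every
smooth divergence-free mean-zero force `f ≠ 0` there are `T₁, ε₁, ν₁ > 0`, `E₁` and `N₀` such that for all
`0 < ν ≤ ν₁`, `N ≥ N₀` and `0 < T ≤ T₁` some mean-zero Galerkin datum `a` of order `N` in the absorbing ball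
`‖a‖₂ ≤ ‖f‖₂/(4π²ν)` has window work `∫₀ᵀ (f, u_t) dt ≥ ε₁T` and window energy `∫₀ᵀ ‖u_t‖₂² dt ≤ E₁T`, with
`(ν, N)`-UNIFORM budgets: `ε₁ = F/4`, `E₁ = 2Fe`, `ν₁ = min 1 (4π²)⁻¹`, `T₁ = min 1 (F/(4C))`, `F = ‖f‖₂²`,
`C = F + ‖Δf‖₂√(2Fe) + G·2Fe`. Datum `a = P_N f` (band test ⇒ Galerkin mode, in the ball once `4π²ν ≤ 1` by
Bessel); energy `≤ 2Fe` on `[0, 1]` (`integral_norm_sq_galerkinFlow_le`); the work `(f, u_t) = (U t, P_N f)`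
(level-`N` slices, lift `stub_orbitLift`) starts above `F/2` (`N ≥ N₀`, Parseval) and has slope `≥ −C` by the
tested Galerkin equations (`IsGalerkinMode.galerkinFlow_clauses`, clause 4; `abs_nsGeneratorPairing_le`), so it
stays `≥ F/4` up to `T₁`. [folklore; Constantin–Foias 1988, Ch. 8, (8.3)–(8.9)] -/
theorem stub_shortHorizonLoud :
    ∀ f : T3 → R3, Torus.IsSmooth f → Torus.IsDivFree f → Torus.HasZeroMean f → f ≠ 0 →
    ∃ T₁ E₁ ε₁ ν₁ : ℝ, 0 < T₁ ∧ 0 < ε₁ ∧ 0 < ν₁ ∧ ∃ N₀ : ℕ, ∀ ν : ℝ, 0 < ν → ν ≤ ν₁ → ∀ N : ℕ, N₀ ≤ N →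
      ∀ T : ℝ, 0 < T → T ≤ T₁ →
      ∃ a : T3 → R3, IsGalerkinMode N a ∧ Torus.HasZeroMean a ∧
        ∫ x, ‖a x‖ ^ 2 ≤ (Real.sqrt (∫ x, ‖f x‖ ^ 2) / (4 * Real.pi ^ 2 * ν)) ^ 2 ∧
        ε₁ * T ≤ ∫ t in (0 : ℝ)..T, ∫ x, ⟪f x, Torus.galerkinFlow ν f N t a x⟫_ℝ ∧
        ∫ t in (0 : ℝ)..T, ∫ x, ‖Torus.galerkinFlow ν f N t a x‖ ^ 2 ≤ E₁ * T := by
  intro f hfs hfd hfz hf0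
  have hf2 : MemLp f 2 volume := hfs.memLp 2
  -- the constants of the force
  set F : ℝ := ∫ x, ‖f x‖ ^ 2 with hFdef
  have hF : 0 < F := GalerkinInvariantLoud.EnergyFloor.integral_norm_sq_pos_of_isSmooth hfs hf0
  obtain ⟨G, hG0, hG⟩ :=
    GalerkinInvariantLoud.EnergyFloor.exists_sum_norm_partialDeriv_fourierTruncate_le hfs
  set L : ℝ := Real.sqrt (∫ x, ‖Torus.laplacian f x‖ ^ 2) with hLdef
  have hL0 : 0 ≤ L := Real.sqrt_nonneg _
  -- the level threshold: `∫‖P_N f‖² > F/2` for `N ≥ N₀`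
  obtain ⟨N₀, hN₀⟩ : ∃ N₀ : ℕ, ∀ N, N₀ ≤ N → F / 2 < ∫ x, ‖Torus.fourierTruncate N f x‖ ^ 2 :=
    eventually_atTop.1
      ((GalerkinInvariantLoud.EnergyFloor.tendsto_integral_norm_sq_fourierTruncate hfs).eventually
        (lt_mem_nhds (by linarith)))
  -- the energy budget on the unit window and the slope of the work
  have hE0 : 0 < 2 * F * Real.exp 1 := by positivity
  set E : ℝ := 2 * F * Real.exp 1 with hEdef
  have hLE : 0 ≤ L * Real.sqrt E + G * E := by positivity
  have hC0 : 0 < F + L * Real.sqrt E + G * E := by linarith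
  set C : ℝ := F + L * Real.sqrt E + G * E with hCdef
  have hT₁ : 0 < min 1 (F / (4 * C)) := lt_min one_pos (by positivity)
  have hν₁ : 0 < min 1 (1 / (4 * Real.pi ^ 2)) := lt_min one_pos (by positivity)
  refine ⟨min 1 (F / (4 * C)), E, F / 4, min 1 (1 / (4 * Real.pi ^ 2)), hT₁, by positivity, hν₁, N₀, ?_⟩
  intro ν hν hνle N hN T hT hTle
  have hν1 : ν ≤ 1 := hνle.trans (min_le_left _ _)
  have hνπ : ν ≤ 1 / (4 * Real.pi ^ 2) := hνle.trans (min_le_right _ _)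
  have hT1 : T ≤ 1 := hTle.trans (min_le_left _ _)
  have hTC : T ≤ F / (4 * C) := hTle.trans (min_le_right _ _)
  -- THE DATUM: the truncated force `a = P_N f`
  set a : T3 → R3 := Torus.fourierTruncate N f with hadef
  have hbt : IsBandTest N a := GalerkinInvariantLoud.EnergyFloor.isBandTest_fourierTruncate hfs hfd hfz N
  have ha : IsGalerkinMode N a := ⟨hbt.1, hbt.2.1, fun k hk => hbt.2.2.2 k fun h =>
    (Torus.not_mem_freqBall.2 hk) (Finset.mem_of_mem_erase h)⟩
  have ha0 : Torus.HasZeroMean a := hbt.2.2.1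
  have has : Torus.IsSmooth a := hbt.1
  have haF : ∫ x, ‖a x‖ ^ 2 ≤ F := Torus.integral_norm_sq_fourierTruncate_le hf2 N
  have hFa : F / 2 < ∫ x, ‖a x‖ ^ 2 := hN₀ N hN
  -- the absorbing ball contains the datum once `4π²ν ≤ 1`
  have hπν : 0 < 4 * Real.pi ^ 2 * ν := by positivity
  have hπν1 : 4 * Real.pi ^ 2 * ν ≤ 1 := by
    have h := (le_div_iff₀ (by positivity : (0 : ℝ) < 4 * Real.pi ^ 2)).1 hνπ
    calc 4 * Real.pi ^ 2 * ν = ν * (4 * Real.pi ^ 2) := mul_comm _ _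
      _ ≤ 1 := h
  have haR : ∫ x, ‖a x‖ ^ 2 ≤ (Real.sqrt F / (4 * Real.pi ^ 2 * ν)) ^ 2 := by
    rw [div_pow, Real.sq_sqrt hF.le, le_div_iff₀ (by positivity)]
    calc (∫ x, ‖a x‖ ^ 2) * (4 * Real.pi ^ 2 * ν) ^ 2 ≤ F * 1 :=
          mul_le_mul haF (pow_le_one₀ hπν.le hπν1) (by positivity) hF.le
      _ = F := mul_one F
  -- zero mean along the orbit (S2) and the `H`-valued lift (S3)
  have hmean : ∀ t, 0 ≤ t → Torus.HasZeroMean (Torus.galerkinFlow ν f N t a) :=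
    fun t ht => stub_meanZeroFlow ν f N a hν.le hfs hfz ha ha0 t ht
  obtain ⟨U, hUc, hU⟩ := stub_orbitLift ν f N a hν.le hfs ha hmean
  have hnorm : ∀ t, 0 ≤ t → ‖U t‖ ^ 2 = ∫ x, ‖Torus.galerkinFlow ν f N t a x‖ ^ 2 := by
    intro t ht
    have h1 : ‖U t‖ = ‖((U t).1 : L2T3)‖ := rfl
    rw [h1, ← Torus.integral_norm_sq_coe_eq]
    exact integral_congr_ae ((hU t ht).2.mono fun x hx => by simp only [hx])
  -- energy on the unit window: `‖U t‖² = ∫‖u_t‖² ≤ E`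
  have hen : ∀ t ∈ Icc (0 : ℝ) 1, ∫ x, ‖Torus.galerkinFlow ν f N t a x‖ ^ 2 ≤ E := fun t ht =>
    integral_norm_sq_galerkinFlow_le hν.le hfs ha (F := F) le_rfl haF ht
  have hUn : ∀ t ∈ Icc (0 : ℝ) 1, ‖U t‖ ≤ Real.sqrt E := fun t ht => by
    rw [← Real.sqrt_sq (norm_nonneg (U t)), hnorm t ht.1]
    exact Real.sqrt_le_sqrt (hen t ht)
  -- the work `W t = ∫⟪f, u_t⟫ = (U t, P_N f)` (the slices are level `N`)
  have hW : ∀ t, 0 ≤ t →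
      ∫ x, ⟪f x, Torus.galerkinFlow ν f N t a x⟫_ℝ = Torus.pairing (U t).1 a := by
    intro t ht
    have hGM : IsGalerkinMode N (Torus.galerkinFlow ν f N t a) := ha.isGalerkinMode_galerkinFlow t
    have hbd : ∀ k ∉ Torus.freqBall N, UnitAddTorus.mFourierCoeff
        (EuclideanSpace.complexify ∘ Torus.galerkinFlow ν f N t a) k = 0 :=
      fun k hk => hGM.mFourierCoeff_eq_zero (Torus.not_mem_freqBall.1 hk)
    rw [← Torus.integral_inner_fourierTruncate_eq hf2 (hGM.isSmooth.memLp 2) hbd]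
    unfold Torus.pairing
    exact integral_congr_ae ((hU t ht).2.mono fun x hx => by
      show ⟪a x, Torus.galerkinFlow ν f N t a x⟫_ℝ = ⟪((U t).1 : T3 → R3) x, a x⟫_ℝ
      rw [hx, real_inner_comm])
  -- the work at time `0`: `(U 0, P_N f) = ‖P_N f‖₂²`
  have hW0 : Torus.pairing (U 0).1 a = ∫ x, ‖a x‖ ^ 2 := by
    rw [← hW 0 le_rfl, Torus.galerkinFlow_zero]
    exact GalerkinInvariantLoud.EnergyFloor.integral_inner_fourierTruncate_self hfs N
  -- the tested Galerkin equations: increments of the work are integrals of the tested generator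
  have hinc : ∀ t, 0 ≤ t → Torus.pairing (U t).1 a - Torus.pairing (U 0).1 a =
      ∫ τ in (0 : ℝ)..t, Torus.nsGeneratorPairing ν f (U τ) a := by
    intro t ht
    have hpair : ∀ s, 0 ≤ s →
        Torus.pairing (U s).1 a = ∫ x, ⟪Torus.galerkinFlow ν f N s a x, a x⟫_ℝ := by
      intro s hs
      simp only [Torus.pairing]
      exact integral_congr_ae ((hU s hs).2.mono fun x hx => by simp only [hx])
    rw [hpair t ht, hpair 0 le_rfl, (ha.galerkinFlow_clauses hν.le hf2).2.2.2.1 a ha 0 t le_rfl ht]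
    refine intervalIntegral.integral_congr fun τ hτ => ?_
    rw [uIcc_of_le ht] at hτ
    exact (Torus.nsGeneratorPairing_eq_flux ν hf2 has (hU τ hτ.1).2).symm
  -- the tested generator is bounded by `C` on the unit window
  have hfa : |∫ x, ⟪f x, a x⟫_ℝ| ≤ F := by
    rw [GalerkinInvariantLoud.EnergyFloor.integral_inner_fourierTruncate_self hfs N,
      abs_of_nonneg (integral_nonneg fun x => by positivity)]
    exact haF
  have hLa : Real.sqrt (∫ x, ‖Torus.laplacian a x‖ ^ 2) ≤ L :=
    Real.sqrt_le_sqrt (GalerkinInvariantLoud.EnergyFloor.integral_norm_sq_laplacian_fourierTruncate_le hfs N)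
  have hrow : ∀ τ ∈ Icc (0 : ℝ) 1, |Torus.nsGeneratorPairing ν f (U τ) a| ≤ C := by
    intro τ hτ
    refine (abs_nsGeneratorPairing_le hν.le f has (hG N) (U τ)).trans ?_
    have h1 : ν * Real.sqrt (∫ x, ‖Torus.laplacian a x‖ ^ 2) * ‖U τ‖ ≤ 1 * L * Real.sqrt E :=
      mul_le_mul (mul_le_mul hν1 hLa (Real.sqrt_nonneg _) zero_le_one) (hUn τ hτ) (norm_nonneg _)
        (mul_nonneg zero_le_one hL0)
    have h2 : G * ‖U τ‖ ^ 2 ≤ G * E := by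
      refine mul_le_mul_of_nonneg_left ?_ hG0
      rw [hnorm τ hτ.1]
      exact hen τ hτ
    rw [hCdef]
    linarith
  -- hence the work stays `≥ F/4` on `[0, T]`
  have hWlow : ∀ t ∈ Icc 0 T, F / 4 ≤ Torus.pairing (U t).1 a := by
    intro t ht
    have ht1 : t ≤ 1 := ht.2.trans hT1
    have hb := intervalIntegral.norm_integral_le_of_norm_le_const (a := (0 : ℝ)) (b := t) (C := C)
      (f := fun τ => Torus.nsGeneratorPairing ν f (U τ) a) ?_
    · rw [sub_zero, abs_of_nonneg ht.1, ← hinc t ht.1, Real.norm_eq_abs, hW0] at hb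
      have hCt : C * t ≤ F / 4 := by
        calc C * t ≤ C * (F / (4 * C)) := mul_le_mul_of_nonneg_left (ht.2.trans hTC) hC0.le
          _ = F / 4 := by field_simp
      have h := (abs_sub_le_iff.1 hb).2
      linarith
    · intro τ hτ
      rw [uIoc_of_le ht.1] at hτ
      rw [Real.norm_eq_abs]
      exact hrow τ ⟨hτ.1.le, hτ.2.trans ht1⟩
  refine ⟨a, ha, ha0, haR, ?_, ?_⟩
  · -- window work `≥ (F/4) T`
    have hcongr : ∫ t in (0 : ℝ)..T, ∫ x, ⟪f x, Torus.galerkinFlow ν f N t a x⟫_ℝ =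
        ∫ t in (0 : ℝ)..T, Torus.pairing (U t).1 a := by
      refine intervalIntegral.integral_congr fun t ht => ?_
      rw [uIcc_of_le hT.le] at ht
      exact hW t ht.1
    have hci : IntervalIntegrable (fun t => Torus.pairing (U t).1 a) volume 0 T :=
      (((Torus.continuous_pairing_coe (has.memLp 2)).comp_continuousOn hUc).mono
        Icc_subset_Ici_self).intervalIntegrable_of_Icc hT.le
    rw [hcongr]
    calc F / 4 * T = ∫ _ in (0 : ℝ)..T, F / 4 := by
          rw [intervalIntegral.integral_const, sub_zero, smul_eq_mul, mul_comm]
      _ ≤ ∫ t in (0 : ℝ)..T, Torus.pairing (U t).1 a :=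
          intervalIntegral.integral_mono_on hT.le intervalIntegrable_const hci hWlow
  · -- window energy `≤ E T`
    have hb := intervalIntegral.norm_integral_le_of_norm_le_const (a := (0 : ℝ)) (b := T) (C := E)
      (f := fun t => ∫ x, ‖Torus.galerkinFlow ν f N t a x‖ ^ 2) ?_
    · rw [sub_zero, abs_of_pos hT] at hb
      exact (Real.le_norm_self _).trans hb
    · intro t ht
      rw [uIoc_of_le hT.le] at ht
      rw [Real.norm_of_nonneg (integral_nonneg fun x => by positivity)]
      exact hen t ⟨ht.1.le, ht.2.trans hT1⟩

end Summit.AnomalousDissipation.AnomalousDissipation.Theorems.MomentParityQuarticTightness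

end
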